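import Literature.AlgebraicGeometry.Motives.CrystallineRealization
import Literature.AlgebraicGeometry.Motives.FermatHypersurface
import Mathlib.RingTheory.WittVector.DiscreteValuationRing
import Mathlib.RingTheory.WittVector.Teichmuller
import HarnessLib

/-!
# The Fermat form over the Witt ring: nonsingularity, and an `m`-th root of `-1`
# (helper for `AnchorsAtGenericHodgeLocusPoints`, stmt-HodgeConjecture-13944)

Route `PadicSemiregularLift` of `HodgeConjecture`, item P2b, Fermat half (B2): the anchor is the Fermat
scheme `Xⁿₘ = V₊(x₀ᵐ + ⋯ + x_{n+1}ᵐ)` over `W = W(𝔽̄_p)` at a prime `p ∤ m` (`p ≡ -1 (mod m)`). For the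
Jacobian criterion over the domain `W` (`…SmoothCutOut.lean`) and for the smoothness / geometric
irreducibility of its two fibres (the tree's `SmoothHypersurface.isSmoothHypersurface_hypersurface_fermatPolynomial`,
which wants `m ≠ 0` in the field and an `m`-th root of `-1`), this file supplies the arithmetic:

* `isNonsingularForm_sum_X_pow_of_isUnit` — over ANY commutative ring in which `m` is a unit, the
  Fermat form `Σ xᵢᵐ` is nonsingular (ring-base version of the tree's `isNonsingularForm_sum_X_pow`);
* `isUnit_natCast_wittVector` — `m` is a unit of `W(k)` when `p ∤ m` (`k` a field of characteristic
  `p`: the zeroth Witt component of `m` is `m ≠ 0` in `k`, Mathlib `WittVector.isUnit_of_coeff_zero_ne_zero`);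
* `isNonsingularForm_fermat_wittVector` — hence the Fermat form is nonsingular over `W(k)` for `p ∤ m`;
* `teichmuller_neg_one` — for odd `p`, the Teichmüller lift of `-1` is `-1`; `exists_pow_eq_neg_one_wittVector`,
  `exists_pow_eq_neg_one_fractionRing` — over an algebraically closed `k` of odd characteristic, `-1` has an
  `m`-th root in `W(k)` and in `K = W(k)[1/p]` (Teichmüller lift of a root in `k`), for every `m ≥ 1`;
* `map_sum_X_pow` — ring homomorphisms send the Fermat form to the Fermat form; over a field the image
  is `Motives.fermatPolynomial` (`map_sum_X_pow_eq_fermatPolynomial`);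
* `natCast_ne_zero_fractionRing_wittVector` — `m ≠ 0` in `K` for `m ≥ 1` (`K` has characteristic `0`).

References: R. Hartshorne, *Algebraic Geometry* (1977), I Ex. 5.5 [Hartshorne1977]; J.-P. Serre,
*Local Fields*, II §4–§6 (Witt vectors, Teichmüller representatives) [folklore].
-/

-- the summit-side namespace `Summit.HodgeConjecture.HodgeConjecture.…` (summit = sub-problem, D-0017)
-- repeats a component by design; the linter would flag every declaration.
set_option linter.dupNamespace false

noncomputable section

open MvPolynomial
open scoped Isocrystal
open Literature.AlgebraicGeometry.Motives Literature.AlgebraicGeometry.Motives.SmoothHypersurface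

universe u

namespace Summit.HodgeConjecture.HodgeConjecture.Theorems.AnchorsAtGenericHodgeLocusPoints

/-! ### The Fermat form is nonsingular wherever `m` is a unit -/

/-- **The Fermat form `Σ xᵢᵐ` is nonsingular over any commutative ring in which `m` is a unit**:
`∂ᵢ = m·xᵢ^{m-1} ∈ 𝔭` gives `xᵢ^{m-1} ∈ 𝔭`, hence `xᵢ ∈ 𝔭` (for `m = 1`, `1 ∈ 𝔭` is absurd).
Ring-base version of the tree's `SmoothHypersurface.isNonsingularForm_sum_X_pow` (Hartshorne I Ex. 5.5,
`p ∤ d`). [cite: Hartshorne1977, I Ex. 5.5] -/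
theorem isNonsingularForm_sum_X_pow_of_isUnit {O : Type u} [CommRing O] {n m : ℕ}
    (hm : IsUnit (m : O)) :
    IsNonsingularForm O (∑ i : Fin (n + 2), (X i : MvPolynomial (Fin (n + 2)) O) ^ m) := by
  intro 𝔭 hp _ hder i
  have h := hder i
  rw [pderiv_sum_X_pow, ← map_natCast (C : O →+* MvPolynomial (Fin (n + 2)) O) m,
    Ideal.unit_mul_mem_iff_mem 𝔭 (hm.map C)] at h
  exact hp.mem_of_pow_mem _ h

/-! ### Units and roots of `-1` in the Witt ring -/

section Witt

variable (p : ℕ) [Fact p.Prime] (k : Type u) [Field k] [CharP k p]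

/-- **`m` is a unit of `W(k)` when `p ∤ m`**: the zeroth Witt component of `m` is `m ∈ k`, non-zero as
`p ∤ m`, and a Witt vector over a field with non-zero zeroth component is a unit (Mathlib
`WittVector.isUnit_of_coeff_zero_ne_zero`). [folklore] -/
theorem isUnit_natCast_wittVector {m : ℕ} (hpm : ¬ p ∣ m) : IsUnit (m : WittVector p k) := by
  refine WittVector.isUnit_of_coeff_zero_ne_zero _ ?_
  rw [← WittVector.constantCoeff_apply, map_natCast]
  exact fun h => hpm ((CharP.cast_eq_zero_iff k p m).1 h)

/-- **The Fermat form is nonsingular over `W(k)` for `p ∤ m`.** [cite: Hartshorne1977, I Ex. 5.5] -/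
theorem isNonsingularForm_fermat_wittVector {n m : ℕ} (hpm : ¬ p ∣ m) :
    IsNonsingularForm (WittVector p k)
      (∑ i : Fin (n + 2), (X i : MvPolynomial (Fin (n + 2)) (WittVector p k)) ^ m) :=
  isNonsingularForm_sum_X_pow_of_isUnit (isUnit_natCast_wittVector p k hpm)

/-- **For odd `p`, the Teichmüller lift of `-1` is `-1`**: `t = τ(-1)` satisfies `t² = τ(1) = 1`, so
`(t - 1)(t + 1) = 0` in the domain `W(k)`, and `t ≠ 1` because its zeroth component is `-1 ≠ 1` in `k`
(`p ≠ 2`). [folklore] -/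
theorem teichmuller_neg_one (hp : p ≠ 2) : WittVector.teichmuller p (-1 : k) = -1 := by
  have h2 : WittVector.teichmuller p (-1 : k) * WittVector.teichmuller p (-1 : k) = 1 := by
    rw [← map_mul, neg_mul_neg, one_mul, map_one]
  have hne : WittVector.teichmuller p (-1 : k) ≠ 1 := by
    intro h
    have h0 := congrArg (fun x : WittVector p k => x.coeff 0) h
    simp only [WittVector.teichmuller_coeff_zero, WittVector.one_coeff_zero] at h0
    -- `-1 = 1` in `k` forces `2 = 0`, i.e. `p ∣ 2`, i.e. `p = 2`
    have h2k : ((2 : ℕ) : k) = 0 := by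
      have : (1 : k) + 1 = 0 := by
        calc (1 : k) + 1 = -1 + 1 := by rw [h0]
          _ = 0 := neg_add_cancel 1
      exact_mod_cast this
    rw [CharP.cast_eq_zero_iff k p] at h2k
    exact hp ((Nat.prime_dvd_prime_iff_eq (Fact.out : p.Prime) Nat.prime_two).1 h2k)
  rcases mul_self_eq_one_iff.1 h2 with h | h
  · exact absurd h hne
  · exact h

/-- **`-1` has an `m`-th root in `W(k)`** for `k` algebraically closed of odd characteristic `p` and
`m ≥ 1`: the Teichmüller lift of an `m`-th root of `-1` in `k`. [folklore] -/
theorem exists_pow_eq_neg_one_wittVector [IsAlgClosed k] (hp : p ≠ 2) {m : ℕ} (hm : 1 ≤ m) :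
    ∃ ζ : WittVector p k, ζ ^ m = -1 := by
  obtain ⟨ζ₀, hζ₀⟩ : ∃ ζ₀ : k, ζ₀ ^ m = -1 := IsAlgClosed.exists_pow_nat_eq (-1) (by omega)
  refine ⟨WittVector.teichmuller p ζ₀, ?_⟩
  rw [← map_pow, hζ₀, teichmuller_neg_one p k hp]

/-- **`-1` has an `m`-th root in `K = W(k)[1/p]`** (`k` algebraically closed of odd characteristic,
`m ≥ 1`). [folklore] -/
theorem exists_pow_eq_neg_one_fractionRing [IsAlgClosed k] (hp : p ≠ 2) {m : ℕ} (hm : 1 ≤ m) :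
    ∃ ζ : K(p, k), ζ ^ m = -1 := by
  obtain ⟨ζ, hζ⟩ := exists_pow_eq_neg_one_wittVector p k hp hm
  exact ⟨algebraMap (WittVector p k) K(p, k) ζ, by rw [← map_pow, hζ, map_neg, map_one]⟩

/-- `K = W(k)[1/p]` has characteristic `0` (it contains the characteristic-`0` domain `W(k)`).
[folklore] -/
theorem charZero_fractionRing_wittVector : CharZero K(p, k) :=
  charZero_of_injective_algebraMap (IsFractionRing.injective (WittVector p k) K(p, k))

/-- `m ≠ 0` in `K = W(k)[1/p]` for `m ≥ 1`. [folklore] -/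
theorem natCast_ne_zero_fractionRing_wittVector {m : ℕ} (hm : 1 ≤ m) : (m : K(p, k)) ≠ 0 := by
  haveI := charZero_fractionRing_wittVector p k
  exact Nat.cast_ne_zero.2 (by omega)

omit [Fact p.Prime] in
/-- `m ≠ 0` in `k` when `p ∤ m`. [folklore] -/
theorem natCast_ne_zero_of_not_dvd {m : ℕ} (hpm : ¬ p ∣ m) : (m : k) ≠ 0 :=
  fun h => hpm ((CharP.cast_eq_zero_iff k p m).1 h)

end Witt

/-! ### Ring homomorphisms preserve the Fermat form -/

/-- A ring homomorphism maps the Fermat form to the Fermat form. [folklore] -/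
theorem map_sum_X_pow {O L : Type*} [CommRing O] [CommRing L] (φ : O →+* L) (n m : ℕ) :
    MvPolynomial.map φ (∑ i : Fin (n + 2), (X i : MvPolynomial (Fin (n + 2)) O) ^ m) =
      ∑ i : Fin (n + 2), (X i : MvPolynomial (Fin (n + 2)) L) ^ m := by
  simp only [map_sum, map_pow, map_X]

/-- Over a field the image of the Fermat form is the tree's `Motives.fermatPolynomial`. [folklore] -/
theorem map_sum_X_pow_eq_fermatPolynomial {O : Type*} [CommRing O] {L : Type u} [Field L]
    (φ : O →+* L) (n m : ℕ) :
    MvPolynomial.map φ (∑ i : Fin (n + 2), (X i : MvPolynomial (Fin (n + 2)) O) ^ m) =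
      fermatPolynomial L n m :=
  map_sum_X_pow φ n m

end Summit.HodgeConjecture.HodgeConjecture.Theorems.AnchorsAtGenericHodgeLocusPoints

end
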